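import Mathlib
import Summits.NavierStokesRegularity.NavierStokesRegularity.Theorems.DssFarFieldSlavingBlowupTypeIDssProfileGaussianHeadPressure
import Literature.Analysis.FluidPDE.CurlFreeLiouville
import HarnessLib

/-!
# The SIGN-COHERENT cell E33 of the rotated profile system is EMPTY at profile level
  (pub-ns-dss theory T42 / row E33, pointwise form; route `DssFarFieldSlaving`, crux
  `BlowupTypeIDssProfile`, stmt-NavierStokesRegularity-0155 — SUPPORT; cell pub-ns-dss, typer seat g4,
  2026-08-22; part 3, imports `…GaussianHeadPressure.lean`)

HONEST FRAMING. Nothing here is a statement about Navier–Stokes regularity or blow-up; an empty cell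
is a solver control / a census ghost index, never evidence about regularity. The theorem is the cell's
theory statement `SignCoherentRdssProfileTrivial` (HOME/theory/GaussianHeadPressureStatements.lean
sha256[16] ef0e7dd54c453371; DERIVED by the theory seat, red g14 ×2 PASS s15; NOT in print — no cite)
WITH TWO ADDED HYPOTHESES (typer): polynomial growth, of any degree `N`, of the time derivative
`∂_sU` and of the pressure gradient `∇_yP`. They are needed for the Gaussian integrals of (E_G) and for
Fubini over a period; in print they are consequences of class membership (Pineau–Vicol 2026, Lemma 7.1,
(7.1)/(7.3): `|∂_sU| ≤ C/(1+|y|)`, `|∇ᵏP| ≤ C/(1+|y|)^{2−σ+k}`); in the tree they follow from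
membership at CUBIC rate (`PineauVicol2026.exists_forall_iteratedFDeriv_lerayOrbit_le`,
`exists_bound_fderiv_pressurePotential`, `norm_timeDerivWithin_le_of_leray` — theory seat g6), a
class-level bridge that is NOT in this file. So this is a PROFILE-level slice lemma with the two
hypotheses named; the sign hypothesis is the POINTWISE form `0 ≤ ⟪y, U⟫·(½|U|² + P)` (red R-73: the
period-MEAN form is a different, larger cell and is not typed here); the pressure gauge is pinned by
the theory seat's decay binder `|P| ≤ C/(1+|y|)`.

STATEMENT (`signCoherent_rdssProfile_trivial`). Let `U : ℝ³ × ℝ → ℝ³`, `P : ℝ³ × ℝ → ℝ` be smooth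
(jointly), `S`-periodic in the similarity time `s` (`S > 0`), solving Pineau–Vicol's rotated
time-dependent profile system (1.14a) slice by slice with angular speed `α`
(`∂_sU + α(JU − DU[Jy]) + ½U + ½DU[y] − ΔU + DU[U] + ∇P = 0`), `div U(·,s) = 0`, pressure Poisson
equation in trace form, with `|U| ≤ C/(1+|y|)`, `‖D_yU‖ ≤ C`, `|P| ≤ C/(1+|y|)`,
`|∂_sU| ≤ C(1+|y|)ᴺ`, `‖∇_yP‖ ≤ C(1+|y|)ᴺ`, and `⟪y, U⟫(½|U|² + P) ≥ 0` everywhere. Then `U ≡ 0`.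

PROOF (theory seat's, typed): by (E_G) (`gaussianHeadPressure_slice_poly`) every slice satisfies
`Z(s) + T(s) = −½∫γ⟪y,U⟫Π`, `Z = ∫γ|curl U|²`, `T = ∫γ⟪U + ½y, ∂_sU⟫`, `Π = ½|U|² + P + ½⟪y,U⟫`;
the sign hypothesis makes `⟪y,U⟫Π = ⟪y,U⟫(½|U|² + P) + ½⟪y,U⟫² ≥ 0`, so `Z + T ≤ 0`. Over a period
`∫₀ˢ T = 0` (`PineauVicol2026.intervalIntegral_integral_weight_mul_inner_deriv_eq_zero`), `Z, T` are
continuous in `s` (dominated convergence), hence `∫₀ˢ Z ≤ 0`, so `Z ≡ 0` on a period and, by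
periodicity, everywhere: every slice is curl-free, divergence-free and bounded, hence constant
(`eq_of_curl_eq_zero_of_isDivFree_of_bounded`), and the decay `|U| ≤ C/(1+|y|)` forces the
constant to vanish. Kinematic non-vacuity of the hypotheses other than the equation: decaying Beltrami
fields have `Π = ½⟪y,U⟫` (theory seat; red s15(d)). [this file; theory T42/E33]
-/

noncomputable section

set_option linter.dupNamespace false

namespace Summit.NavierStokesRegularity.NavierStokesRegularity.Theorems.GaussianHeadPressure

open Set Function Filter MeasureTheory InnerProductSpace intervalIntegral
open scoped RealInnerProductSpace Laplacian ContDiff Topology BigOperators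
open Literature.Analysis Literature.Analysis.FluidPDE Literature.Analysis.FluidPDE.PineauVicol2026
open Summit.NavierStokesRegularity.NavierStokesRegularity.Theorems

/-- **A bounded field with the decay `|V(y)| ≤ C/(1+|y|)` that is constant vanishes.** [folklore] -/
theorem eq_zero_of_const_of_decay {C : ℝ}
    {V : EuclideanSpace ℝ (Fin 3) → EuclideanSpace ℝ (Fin 3)}
    (hconst : ∀ y, V y = V 0) (hdecay : ∀ y, ‖V y‖ ≤ C / (1 + ‖y‖)) (y : EuclideanSpace ℝ (Fin 3)) :
    V y = 0 := by
  rw [hconst y]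
  by_contra hne
  have ha : 0 < ‖V 0‖ := norm_pos_iff.mpr hne
  obtain ⟨n, hn⟩ := exists_nat_gt (C / ‖V 0‖)
  set e : EuclideanSpace ℝ (Fin 3) := EuclideanSpace.single 0 (1 : ℝ) with he_def
  have he : ‖e‖ = 1 := by simp [he_def]
  have hy : ‖(n : ℝ) • e‖ = n := by
    rw [norm_smul, he, mul_one, Real.norm_of_nonneg (Nat.cast_nonneg n)]
  have h1 := hdecay ((n : ℝ) • e)
  rw [hconst ((n : ℝ) • e), hy] at h1
  have h2 : ‖V 0‖ * (1 + n) ≤ C := (le_div_iff₀ (by positivity)).mp h1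
  have h3 : C < ‖V 0‖ * n := (div_lt_iff₀' ha).mp hn
  nlinarith [ha]

/-- **E33, sign-coherent cell, PROFILE level, with polynomial growth bounds (degree `N`) on `∂_sU`
and `∇_yP` added to the theory seat's hypotheses** (see the module docstring for the exact list and
the provenance of the two added hypotheses). A smooth `S`-periodic solution `U(y,s)` of the rotated
profile system (any angular speed `α`), divergence free slice by slice, with the pressure Poisson
equation in trace form, the profile bounds `|U| ≤ C/(1+|y|)`, `‖D_yU‖ ≤ C`, `|P| ≤ C/(1+|y|)`,
`|∂_sU| ≤ C(1+|y|)ᴺ`, `‖∇_yP‖ ≤ C(1+|y|)ᴺ`, and the POINTWISE sign condition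
`0 ≤ ⟪y, U(y,s)⟫ · (½|U(y,s)|² + P(y,s))` for all `s, y`, is identically zero.
[this file; theory T42/E33, HOME/theory/GaussianHeadPressureStatements.lean ef0e7dd54c453371] -/
theorem signCoherent_rdssProfile_trivial {N : ℕ}
    {U : EuclideanSpace ℝ (Fin 3) → ℝ → EuclideanSpace ℝ (Fin 3)}
    {P : EuclideanSpace ℝ (Fin 3) → ℝ → ℝ} {α S C : ℝ} (hS : 0 < S)
    (hUj : ContDiff ℝ ∞ (fun q : EuclideanSpace ℝ (Fin 3) × ℝ => U q.1 q.2))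
    (hPj : ContDiff ℝ ∞ (fun q : EuclideanSpace ℝ (Fin 3) × ℝ => P q.1 q.2))
    (hperU : ∀ y s, U y (s + S) = U y s) (hperP : ∀ y s, P y (s + S) = P y s)
    (heq : ∀ s y, fderiv ℝ (fun σ => U y σ) s 1 +
        α • (rotGen (U y s) - fderiv ℝ (fun z => U z s) y (rotGen y)) +
        (1 / 2 : ℝ) • U y s + (1 / 2 : ℝ) • fderiv ℝ (fun z => U z s) y y -
        (Δ (fun z => U z s)) y + convect (fun z => U z s) (fun z => U z s) y +
        gradient (fun z => P z s) y = 0)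
    (hdiv : ∀ s, VectorCalculus.IsDivFree fun z => U z s)
    (hΔP : ∀ s y, ∑ l, pderiv l (pderiv l fun z => P z s) y =
      -∑ l, ∑ j, pderiv l (fun z => U z s j) y * pderiv j (fun z => U z s l) y)
    (hUb : ∀ s y, ‖U y s‖ ≤ C / (1 + ‖y‖)) (hDUb : ∀ s y, ‖fderiv ℝ (fun z => U z s) y‖ ≤ C)
    (hPb : ∀ s y, |P y s| ≤ C / (1 + ‖y‖))
    (hUsb : ∀ s y, ‖fderiv ℝ (fun σ => U y σ) s 1‖ ≤ C * (1 + ‖y‖) ^ N)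
    (hgPb : ∀ s y, ‖gradient (fun z => P z s) y‖ ≤ C * (1 + ‖y‖) ^ N)
    (hsign : ∀ s y, 0 ≤ ⟪y, U y s⟫ * (2⁻¹ * ‖U y s‖ ^ 2 + P y s)) :
    ∀ y s, U y s = 0 := by
  have _ := hperP
  -- the joint field and the constant `C ≥ 0`
  set Uj : EuclideanSpace ℝ (Fin 3) × ℝ → EuclideanSpace ℝ (Fin 3) := fun q => U q.1 q.2 with hUj_def
  have hC : 0 ≤ C := (norm_nonneg _).trans (hDUb 0 0)
  have h1y : ∀ y : EuclideanSpace ℝ (Fin 3), (1 : ℝ) ≤ 1 + ‖y‖ := fun y => by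
    linarith [norm_nonneg y]
  -- smoothness of slices and time lines
  have hUsl : ∀ s, ContDiff ℝ ∞ (fun z => U z s) := fun s =>
    hUj.comp (contDiff_id.prodMk contDiff_const)
  have hPsl : ∀ s, ContDiff ℝ ∞ (fun z => P z s) := fun s =>
    hPj.comp (contDiff_id.prodMk contDiff_const)
  have hUt : ∀ y, ContDiff ℝ ∞ (fun σ => U y σ) := fun y =>
    hUj.comp (contDiff_const.prodMk contDiff_id)
  have hUjd : Differentiable ℝ Uj := hUj.differentiable (by simp)
  have cDUj : Continuous (fderiv ℝ Uj) := hUj.continuous_fderiv (by simp)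
  -- the time derivative and the slice derivative through the joint derivative
  have hUs_eq : ∀ y s, fderiv ℝ (fun σ => U y σ) s 1 =
      fderiv ℝ Uj (y, s) ((0 : EuclideanSpace ℝ (Fin 3)), (1 : ℝ)) := by
    intro y s
    have h := ((hUjd (y, s)).hasFDerivAt.comp s (hasFDerivAt_prodMk_right (𝕜 := ℝ) y s))
    rw [show (fun σ => U y σ) = Uj ∘ fun σ => (y, σ) from rfl, h.fderiv]
    simp
  have hUy_eq : ∀ y s, fderiv ℝ (fun z => U z s) y =
      (fderiv ℝ Uj (y, s)).comp (ContinuousLinearMap.inl ℝ (EuclideanSpace ℝ (Fin 3)) ℝ) := by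
    intro y s
    have h := ((hUjd (y, s)).hasFDerivAt.comp y (hasFDerivAt_prodMk_left (𝕜 := ℝ) y s))
    rw [show (fun z => U z s) = Uj ∘ fun z => (z, s) from rfl, h.fderiv]
  have hUs_y : ∀ s, ContDiff ℝ 1 (fun y => fderiv ℝ (fun σ => U y σ) s 1) := by
    intro s
    have e : (fun y => fderiv ℝ (fun σ => U y σ) s 1) =
        fun y => fderiv ℝ Uj (y, s) ((0 : EuclideanSpace ℝ (Fin 3)), (1 : ℝ)) :=
      funext fun y => hUs_eq y s
    rw [e]
    exact ((hUj.fderiv_right (m := 1) (by norm_cast)).comp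
      (contDiff_id.prodMk contDiff_const)).clm_apply contDiff_const
  -- slice bounds in the shape of (E_G)
  have hUb' : ∀ s y, ‖U y s‖ ≤ C := fun s y => (hUb s y).trans (div_le_self hC (h1y y))
  have hPb' : ∀ s y, |P y s| ≤ C * (1 + ‖y‖) ^ N := fun s y =>
    (hPb s y).trans ((div_le_self hC (h1y y)).trans
      (le_mul_of_one_le_right hC (one_le_pow₀ (h1y y))))
  -- Gaussian enstrophy `Z` and the time-derivative pairing `T` of each slice
  set Z : ℝ → ℝ := fun s => ∫ y, gaussWeight y * ‖curl (fun z => U z s) y‖ ^ 2 with hZ_def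
  set T : ℝ → ℝ := fun s =>
    ∫ y, gaussWeight y * ⟪U y s + (1 / 2 : ℝ) • y, fderiv ℝ (fun σ => U y σ) s 1⟫ with hT_def
  -- (E_G) and the sign hypothesis: `Z + T ≤ 0`
  have hZT : ∀ s, Z s + T s ≤ 0 := by
    intro s
    have hid := gaussianHeadPressure_slice_poly (N := N)
      (Us := fun y => fderiv ℝ (fun σ => U y σ) s 1) (hUsl s) (hPsl s) (hUs_y s) (heq s) (hdiv s)
      (hΔP s) (hUb' s) (hDUb s) (hUsb s) (hPb' s) (hgPb s)
    have hnn : 0 ≤ ∫ y, gaussWeight y *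
        (⟪y, U y s⟫ * headPressure (1 / 2) (fun z => U z s) (fun z => P z s) y) := by
      refine integral_nonneg fun y => mul_nonneg (gaussWeight_pos y).le ?_
      rw [headPressure_apply]
      have e : ⟪y, U y s⟫ * (2⁻¹ * ‖U y s‖ ^ 2 + P y s + 1 / 2 * ⟪y, U y s⟫) =
          ⟪y, U y s⟫ * (2⁻¹ * ‖U y s‖ ^ 2 + P y s) + 1 / 2 * ⟪y, U y s⟫ ^ 2 := by ring
      rw [e]
      nlinarith [hsign s y, sq_nonneg ⟪y, U y s⟫]
    have hZs : Z s = ∫ y, gaussWeight y * ‖curl (fun z => U z s) y‖ ^ 2 := rfl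
    have hTs : T s = ∫ y, gaussWeight y *
        ⟪U y s + (1 / 2 : ℝ) • y, fderiv ℝ (fun σ => U y σ) s 1⟫ := rfl
    rw [hZs, hTs, hid]
    linarith
  -- pointwise bounds of the two integrands
  have hZb : ∀ s y, ‖gaussWeight y * ‖curl (fun z => U z s) y‖ ^ 2‖ ≤
      (‖curlCLM‖ * C) ^ 2 * gaussWeight y := by
    intro s y
    rw [Real.norm_eq_abs, abs_mul, abs_of_pos (gaussWeight_pos y), abs_of_nonneg (by positivity),
      mul_comm]
    exact mul_le_mul_of_nonneg_right (rotationDefect_norm_curl_sq_le (hDUb s) y) (gaussWeight_pos y).le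
  have hTb : ∀ s y, ‖gaussWeight y * ⟪U y s + (1 / 2 : ℝ) • y, fderiv ℝ (fun σ => U y σ) s 1⟫‖ ≤
      (C + 1) * C * (1 + ‖y‖) ^ (N + 1) * gaussWeight y := by
    intro s y
    rw [Real.norm_eq_abs, abs_mul, abs_of_pos (gaussWeight_pos y)]
    have h1 : |⟪U y s + (1 / 2 : ℝ) • y, fderiv ℝ (fun σ => U y σ) s 1⟫| ≤
        (C + 1) * (1 + ‖y‖) * (C * (1 + ‖y‖) ^ N) :=
      (abs_real_inner_le_norm _ _).trans (mul_le_mul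
        (rotationDefect_norm_drift_le (U := fun z => U z s) hC (hUb' s) y) (hUsb s y)
        (norm_nonneg _) (by positivity))
    calc gaussWeight y * |⟪U y s + (1 / 2 : ℝ) • y, fderiv ℝ (fun σ => U y σ) s 1⟫|
        ≤ gaussWeight y * ((C + 1) * (1 + ‖y‖) * (C * (1 + ‖y‖) ^ N)) :=
          mul_le_mul_of_nonneg_left h1 (gaussWeight_pos y).le
      _ = (C + 1) * C * (1 + ‖y‖) ^ (N + 1) * gaussWeight y := by ring
  have iZb : Integrable fun y : EuclideanSpace ℝ (Fin 3) => (‖curlCLM‖ * C) ^ 2 * gaussWeight y :=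
    integrable_gaussWeight.const_mul _
  have iTb : Integrable fun y : EuclideanSpace ℝ (Fin 3) =>
      (C + 1) * C * (1 + ‖y‖) ^ (N + 1) * gaussWeight y := by
    refine integrable_of_le_poly_gaussWeight (by fun_prop) (K := (C + 1) * C) (N := N + 1)
      fun y => ?_
    have hγ0 := (gaussWeight_pos y).le
    rw [Real.norm_eq_abs, abs_of_nonneg (by positivity)]
  -- continuity in `s` of the two integrands, pointwise in `y`
  have cZy : ∀ y, Continuous fun s => gaussWeight y * ‖curl (fun z => U z s) y‖ ^ 2 := by
    intro y
    have e : (fun s => curl (fun z => U z s) y) = fun s =>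
        curlCLM ((fderiv ℝ Uj (y, s)).comp
          (ContinuousLinearMap.inl ℝ (EuclideanSpace ℝ (Fin 3)) ℝ)) := by
      funext s
      rw [show curl (fun z => U z s) y = curlCLM (fderiv ℝ (fun z => U z s) y) from rfl, hUy_eq]
    have c1 : Continuous fun s => curl (fun z => U z s) y := by
      rw [e]
      exact curlCLM.continuous.comp
        (((cDUj.comp (continuous_const.prodMk continuous_id)).clm_comp continuous_const))
    exact continuous_const.mul ((continuous_norm.comp c1).pow 2)
  have cTy : ∀ y, Continuous fun s =>
      gaussWeight y * ⟪U y s + (1 / 2 : ℝ) • y, fderiv ℝ (fun σ => U y σ) s 1⟫ := by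
    intro y
    have c1 : Continuous fun s => U y s := (hUt y).continuous
    have c2 : Continuous fun s => fderiv ℝ (fun σ => U y σ) s 1 :=
      ((hUt y).continuous_fderiv (by simp)).clm_apply continuous_const
    exact continuous_const.mul ((c1.add continuous_const).inner c2)
  -- measurability in `y` of the two integrands, for each `s`
  have mZ : ∀ s, AEStronglyMeasurable (fun y => gaussWeight y * ‖curl (fun z => U z s) y‖ ^ 2)
      volume := fun s =>
    (continuous_gaussWeight.mul ((continuous_norm.comp
      (continuous_curl ((hUsl s).of_le (by norm_cast)))).pow 2)).aestronglyMeasurable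
  have mT : ∀ s, AEStronglyMeasurable (fun y =>
      gaussWeight y * ⟪U y s + (1 / 2 : ℝ) • y, fderiv ℝ (fun σ => U y σ) s 1⟫) volume := by
    intro s
    have c1 : Continuous fun y => U y s := (hUsl s).continuous
    have c2 : Continuous fun y => fderiv ℝ (fun σ => U y σ) s 1 := (hUs_y s).continuous
    have c3 : Continuous fun y : EuclideanSpace ℝ (Fin 3) => (1 / 2 : ℝ) • y := by fun_prop
    exact (continuous_gaussWeight.mul ((c1.add c3).inner c2)).aestronglyMeasurable
  -- `Z` and `T` are continuous (dominated convergence)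
  have cZ : Continuous Z :=
    continuous_of_dominated mZ (fun s => Eventually.of_forall (hZb s)) iZb
      (Eventually.of_forall cZy)
  have cT : Continuous T :=
    continuous_of_dominated mT (fun s => Eventually.of_forall (hTb s)) iTb
      (Eventually.of_forall cTy)
  -- the period integral of `T` vanishes
  have hT0 : ∫ s in (0 : ℝ)..S, T s = 0 := by
    refine intervalIntegral_integral_weight_mul_inner_deriv_eq_zero (μ := volume)
      (U := U) (Us := fun y s => fderiv ℝ (fun σ => U y σ) s 1) hS.le gaussWeight
      (fun y s => ((hUt y).differentiable (by simp) s).hasDerivAt)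
      (fun y => ((hUt y).continuous_fderiv (by simp)).clm_apply continuous_const)
      (fun y => (hUt y).continuous) (fun y => by simpa using hperU y 0) ?_
    -- joint integrability on `(0, S] × ℝ³`
    have e : (fun p : ℝ × EuclideanSpace ℝ (Fin 3) => gaussWeight p.2 *
        ⟪U p.2 p.1 + (1 / 2 : ℝ) • p.2, fderiv ℝ (fun σ => U p.2 σ) p.1 1⟫) =
        fun p => gaussWeight p.2 * ⟪Uj (p.2, p.1) + (1 / 2 : ℝ) • p.2,
          fderiv ℝ Uj (p.2, p.1) ((0 : EuclideanSpace ℝ (Fin 3)), (1 : ℝ))⟫ := by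
      funext p; rw [hUs_eq]
    have cI : Continuous fun p : ℝ × EuclideanSpace ℝ (Fin 3) => gaussWeight p.2 *
        ⟪U p.2 p.1 + (1 / 2 : ℝ) • p.2, fderiv ℝ (fun σ => U p.2 σ) p.1 1⟫ := by
      rw [e]
      have csw : Continuous fun p : ℝ × EuclideanSpace ℝ (Fin 3) => (p.2, p.1) :=
        continuous_snd.prodMk continuous_fst
      have cU2 : Continuous fun p : ℝ × EuclideanSpace ℝ (Fin 3) => Uj (p.2, p.1) :=
        hUj.continuous.comp csw
      have cy2 : Continuous fun p : ℝ × EuclideanSpace ℝ (Fin 3) => (1 / 2 : ℝ) • p.2 := by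
        fun_prop
      have cD2 : Continuous fun p : ℝ × EuclideanSpace ℝ (Fin 3) =>
          fderiv ℝ Uj (p.2, p.1) ((0 : EuclideanSpace ℝ (Fin 3)), (1 : ℝ)) :=
        (cDUj.comp csw).clm_apply continuous_const
      have cγ2 : Continuous fun p : ℝ × EuclideanSpace ℝ (Fin 3) => gaussWeight p.2 :=
        continuous_gaussWeight.comp continuous_snd
      exact cγ2.mul ((cU2.add cy2).inner cD2)
    have h1 : Integrable (fun _ : ℝ => (1 : ℝ)) (volume.restrict (Ioc 0 S)) :=
      (continuous_const.integrableOn_Icc (a := 0) (b := S)).mono_set Ioc_subset_Icc_self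
    refine Integrable.mono' (h1.mul_prod iTb) cI.aestronglyMeasurable (Eventually.of_forall fun p => ?_)
    rw [one_mul]
    exact hTb p.1 p.2
  -- hence `∫₀ˢ Z ≤ 0`, so `Z ≡ 0` on `[0, S]`
  have hZnn : ∀ s, 0 ≤ Z s := fun s =>
    integral_nonneg fun y => mul_nonneg (gaussWeight_pos y).le (by positivity)
  have hZint : ∫ s in (0 : ℝ)..S, Z s ≤ 0 := by
    have h : ∫ s in (0 : ℝ)..S, Z s ≤ ∫ s in (0 : ℝ)..S, -T s :=
      intervalIntegral.integral_mono_on (μ := volume) hS.le (cZ.intervalIntegrable _ _)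
        (cT.neg.intervalIntegrable _ _) (fun s _ => show Z s ≤ -T s by linarith [hZT s])
    rw [intervalIntegral.integral_neg, hT0, neg_zero] at h
    exact h
  have hZ0 : ∀ s ∈ Icc (0 : ℝ) S, Z s = 0 := by
    intro s₀ hs₀
    by_contra hne
    have hpos : 0 < ∫ s in (0 : ℝ)..S, Z s :=
      intervalIntegral.integral_pos hS cZ.continuousOn (fun s _ => hZnn s)
        ⟨s₀, hs₀, lt_of_le_of_ne (hZnn s₀) (Ne.symm hne)⟩
    linarith
  -- `Z(s) = 0` forces `curl U(·, s) ≡ 0`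
  have hcurl0 : ∀ s ∈ Icc (0 : ℝ) S, ∀ y, curl (fun z => U z s) y = 0 := by
    intro s hs y
    have hint : Integrable fun y => gaussWeight y * ‖curl (fun z => U z s) y‖ ^ 2 :=
      iZb.mono' (mZ s) (Eventually.of_forall (hZb s))
    have hae := (integral_eq_zero_iff_of_nonneg
      (fun y => mul_nonneg (gaussWeight_pos y).le (by positivity)) hint).mp (hZ0 s hs)
    have hcont : Continuous fun y => gaussWeight y * ‖curl (fun z => U z s) y‖ ^ 2 :=
      continuous_gaussWeight.mul ((continuous_norm.comp
        (continuous_curl ((hUsl s).of_le (by norm_cast)))).pow 2)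
    have hfun := (hcont.ae_eq_iff_eq (μ := volume) continuous_const).mp hae
    have hy : gaussWeight y * ‖curl (fun z => U z s) y‖ ^ 2 = 0 := congrFun hfun y
    have h2 : ‖curl (fun z => U z s) y‖ ^ 2 = 0 :=
      (mul_eq_zero.mp hy).resolve_left (gaussWeight_pos y).ne'
    exact norm_eq_zero.mp ((pow_eq_zero_iff two_ne_zero).mp h2)
  -- periodicity: every slice is a slice with `s ∈ [0, S)`
  have hcurl : ∀ s y, curl (fun z => U z s) y = 0 := by
    intro s y
    have hmem := toIcoMod_mem_Ico hS 0 s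
    have hdec := toIcoMod_add_toIcoDiv_zsmul hS 0 s
    set s' := toIcoMod hS 0 s with hs'
    set n := toIcoDiv hS 0 s with hn
    have hfun : (fun z => U z s) = fun z => U z s' := by
      funext z
      have hp : Function.Periodic (fun σ => U z σ) S := fun σ => hperU z σ
      rw [← hdec]
      exact hp.zsmul n s'
    rw [hfun]
    rw [zero_add] at hmem
    exact hcurl0 s' ⟨hmem.1, hmem.2.le⟩ y
  -- curl-free, divergence-free, bounded slices are constant; decay makes them vanish
  intro y s
  have hconst : ∀ z, U z s = U 0 s := fun z =>
    eq_of_curl_eq_zero_of_isDivFree_of_bounded ((hUsl s).of_le (by norm_cast)) (hcurl s) (hdiv s)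
      (hUb' s) z 0
  exact eq_zero_of_const_of_decay (V := fun z => U z s) hconst (hUb s) y


/-- **E33 in the theory seat's binder order** — the statement `SignCoherentRdssProfileTrivial` of
HOME/theory/GaussianHeadPressureStatements.lean (sha256[16] ef0e7dd54c453371) binder for binder
(`E3` written out), with the typer's TWO ADDED HYPOTHESES inserted immediately before the sign
condition: for some degree `N`, `|∂_sU(y,s)| ≤ C(1+|y|)ᴺ` and `‖∇_yP(y,s)‖ ≤ C(1+|y|)ᴺ` (printed
consequences of class membership, Pineau–Vicol 2026 Lemma 7.1 (7.1)/(7.3); tree consequences at cubic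
rate — see the module docstring; the class-level bridge is not in this file). POINTWISE sign form
(red R-73). Proof: `signCoherent_rdssProfile_trivial`. [this file; theory T42/E33] -/
theorem signCoherentRdssProfileTrivial_of_polyGrowth :
    ∀ (U : EuclideanSpace ℝ (Fin 3) → ℝ → EuclideanSpace ℝ (Fin 3))
      (P : EuclideanSpace ℝ (Fin 3) → ℝ → ℝ) (α S C : ℝ), 0 < S →
    ContDiff ℝ ∞ (fun q : EuclideanSpace ℝ (Fin 3) × ℝ => U q.1 q.2) →
    ContDiff ℝ ∞ (fun q : EuclideanSpace ℝ (Fin 3) × ℝ => P q.1 q.2) →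
    (∀ y s, U y (s + S) = U y s) → (∀ y s, P y (s + S) = P y s) →
    (∀ s y, fderiv ℝ (fun σ => U y σ) s 1 +
        α • (rotGen (U y s) - fderiv ℝ (fun z => U z s) y (rotGen y)) +
        (1 / 2 : ℝ) • U y s + (1 / 2 : ℝ) • fderiv ℝ (fun z => U z s) y y -
        (Δ (fun z => U z s)) y + convect (fun z => U z s) (fun z => U z s) y +
        gradient (fun z => P z s) y = 0) →
    (∀ s, VectorCalculus.IsDivFree fun z => U z s) →
    (∀ s y, ∑ l, pderiv l (pderiv l fun z => P z s) y =
      -∑ l, ∑ j, pderiv l (fun z => U z s j) y * pderiv j (fun z => U z s l) y) →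
    (∀ s y, ‖U y s‖ ≤ C / (1 + ‖y‖)) → (∀ s y, ‖fderiv ℝ (fun z => U z s) y‖ ≤ C) →
    (∀ s y, |P y s| ≤ C / (1 + ‖y‖)) →
    ∀ N : ℕ, (∀ s y, ‖fderiv ℝ (fun σ => U y σ) s 1‖ ≤ C * (1 + ‖y‖) ^ N) →
    (∀ s y, ‖gradient (fun z => P z s) y‖ ≤ C * (1 + ‖y‖) ^ N) →
    (∀ s y, 0 ≤ ⟪y, U y s⟫ * (2⁻¹ * ‖U y s‖ ^ 2 + P y s)) →
    ∀ y s, U y s = 0 := by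
  intro U P α S C hS hUj hPj hperU hperP heq hdiv hΔP hUb hDUb hPb N hUsb hgPb hsign
  exact signCoherent_rdssProfile_trivial hS hUj hPj hperU hperP heq hdiv hΔP hUb hDUb hPb hUsb hgPb
    hsign

end Summit.NavierStokesRegularity.NavierStokesRegularity.Theorems.GaussianHeadPressure

end
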